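import Mathlib.MeasureTheory.Measure.Lebesgue.Basic
import Mathlib.Data.Fin.Tuple.Basic
import HarnessLib

/-!
# Skorokhod embedding, finite bookkeeping: weighted selection and the two-point mixture

Topic `Probability/RandomPlanarGeometry` (support file for the Skorokhod embedding of
Lawler–Schramm–Werner (2004), Lemma 3.8 / Durrett (2019), Thms. 8.1.1, 8.2.1). Everything here is
PROVED; no named fact is introduced; everything lives in the sub-namespace `SkorokhodEmbedding`.
Two elementary, purely finite ingredients:

* **Weighted selection driven by a uniform variable** (the randomisation in Durrett's proof of
  Thm. 8.1.1: "let `(U, V)` have distribution (8.1.1) … and an independent Brownian motion"):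
  for weights `w : Fin n → ℝ`, `finSelect w u` is the first index whose cumulative weight exceeds
  `u`; if `w ≥ 0` and `∑ w = 1` then `{u ∈ [0,1) | finSelect w u = k}` is the interval
  `[∑_{i<k} w i, ∑_{i≤k} w i)` of Lebesgue measure `w k` (`volume_Ico_inter_finSelect`), and
  `finSelect w` is measurable; `wselect` is the same for a weighted finite set.
* **The centred two-point mixture, indexed by children** (Durrett (2019), proof of Thm. 8.1.1,
  formula (8.1.1), in the finitely supported case and keeping track of indices rather than
  values): for a finite set `C` of "children" with probabilities `p ≥ 0`, `∑ p = 1`, and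
  increments `x` with `∑ p · x = 0`, the pair weights
  `pairWeight C p x (i, j) = (x j - x i) p i p j / c⁺` for `x i < 0 < x j`
  (`c⁺ = ∑_{x j > 0} x j p j`), `= p i` for the "zero pair" `i = j`, `x i = 0`, and `0` otherwise,
  are nonnegative and reproduce `p` through the exit probabilities of Brownian motion from
  `(x i, x j)`: for every test function `φ`,
  `∑_{(i,j)} pairWeight (i,j) · pairAverage x (i,j) φ = ∑_k p k φ k` (`sum_pairWeight_mul_pairAverage`),
  where `pairAverage x (i,j) φ = (x j φ i - x i φ j)/(x j - x i)` is the mean of `φ` under the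
  exit distribution `P[exit at x i] = x j/(x j - x i)` (gambler's ruin, `BrownianExitInterval`).

## References

* R. Durrett, *Probability: Theory and Examples*, 5th ed. (2019), Thm. 8.1.1 and (8.1.1).
* G. F. Lawler, O. Schramm, W. Werner, Ann. Probab. 32 (2004), Lemma 3.8.
-/

noncomputable section

open MeasureTheory Finset
open scoped ENNReal

namespace Literature.Probability.RandomPlanarGeometry.SkorokhodEmbedding

/-! ### Cumulative weights and selection on `Fin n` -/

section FinSelect

variable {n : ℕ}

/-- Cumulative weight `∑_{i ≤ k} w i`. [folklore] -/
def cumSum (w : Fin n → ℝ) (k : Fin n) : ℝ := ∑ i ∈ univ.filter (· ≤ k), w i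

/-- Strict cumulative weight `∑_{i < k} w i`. [folklore] -/
def cumSumLT (w : Fin n → ℝ) (k : Fin n) : ℝ := ∑ i ∈ univ.filter (· < k), w i

/-- `∑_{i ≤ k} w i = ∑_{i < k} w i + w k`. [folklore] -/
theorem cumSum_eq_cumSumLT_add (w : Fin n → ℝ) (k : Fin n) : cumSum w k = cumSumLT w k + w k := by
  rw [cumSum, cumSumLT, sum_filter, sum_filter]
  have hpt : ∀ i : Fin n, (if i ≤ k then w i else 0) =
      (if i < k then w i else 0) + (if i = k then w i else 0) := by
    intro i
    rcases lt_trichotomy i k with h | h | h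
    · rw [if_pos h.le, if_pos h, if_neg h.ne, add_zero]
    · subst h
      rw [if_pos le_rfl, if_neg (lt_irrefl _), if_pos rfl, zero_add]
    · rw [if_neg (not_le.2 h), if_neg (not_lt.2 h.le), if_neg h.ne', add_zero]
  rw [sum_congr rfl fun i _ ↦ hpt i, sum_add_distrib, sum_ite_eq' univ k, if_pos (mem_univ _)]

/-- For nonnegative weights, `j < k` implies `∑_{i ≤ j} w i ≤ ∑_{i < k} w i`. [folklore] -/
theorem cumSum_le_cumSumLT_of_lt {w : Fin n → ℝ} (hw : ∀ i, 0 ≤ w i) {j k : Fin n} (hjk : j < k) :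
    cumSum w j ≤ cumSumLT w k :=
  sum_le_sum_of_subset_of_nonneg (fun i hi ↦ by
    rw [mem_filter] at hi ⊢
    exact ⟨hi.1, lt_of_le_of_lt hi.2 hjk⟩)
    fun i _ _ ↦ hw i

/-- For nonnegative weights the cumulative weights are nonnegative. [folklore] -/
theorem cumSumLT_nonneg {w : Fin n → ℝ} (hw : ∀ i, 0 ≤ w i) (k : Fin n) : 0 ≤ cumSumLT w k :=
  sum_nonneg fun i _ ↦ hw i

/-- The cumulative weights are bounded by the total weight. [folklore] -/
theorem cumSum_le_sum {w : Fin n → ℝ} (hw : ∀ i, 0 ≤ w i) (k : Fin n) : cumSum w k ≤ ∑ i, w i :=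
  sum_le_sum_of_subset_of_nonneg (filter_subset _ _) fun i _ _ ↦ hw i

/-- At the top index the cumulative weight is the total weight. [folklore] -/
theorem cumSum_last (w : Fin (n + 1) → ℝ) : cumSum w (Fin.last n) = ∑ i, w i := by
  rw [cumSum]
  congr 1
  ext i
  simp [Fin.le_last]

/-- If `∑_{i<k} w i > u ≥ 0` then some `j < k` already has `∑_{i ≤ j} w i > u`. [folklore] -/
theorem exists_lt_cumSum_of_lt_cumSumLT {w : Fin n → ℝ} {u : ℝ} (hu : 0 ≤ u) {k : Fin n}
    (h : u < cumSumLT w k) : ∃ j < k, u < cumSum w j := by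
  have hk : 0 < (k : ℕ) := by
    by_contra h0
    have hk0 : (k : ℕ) = 0 := by omega
    have : univ.filter (fun i : Fin n ↦ i < k) = ∅ := by
      ext i
      simp only [mem_filter, Finset.mem_univ, true_and, Finset.notMem_empty, iff_false]
      rw [Fin.lt_def, hk0]
      exact Nat.not_lt_zero _
    rw [cumSumLT, this, sum_empty] at h
    linarith
  set j : Fin n := ⟨(k : ℕ) - 1, by omega⟩ with hj
  have hjv : (j : ℕ) = (k : ℕ) - 1 := rfl
  have hjk : j < k := by
    rw [Fin.lt_def, hjv]
    omega
  refine ⟨j, hjk, ?_⟩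
  have hset : univ.filter (fun i : Fin n ↦ i < k) = univ.filter (· ≤ j) := by
    ext i
    simp only [mem_filter, Finset.mem_univ, true_and]
    rw [Fin.lt_def, Fin.le_def, hjv]
    omega
  rwa [cumSumLT, hset] at h

variable [NeZero n]

/-- **Weighted selection**: the first index whose cumulative weight exceeds `u` (junk `0` if there
is none, which does not happen for `u < ∑ w`). Durrett (2019), proof of Thm. 8.1.1 (the
randomisation `(U, V)`). [folklore] -/
def finSelect (w : Fin n → ℝ) (u : ℝ) : Fin n :=
  if h : ∃ k, u < cumSum w k then Fin.find _ h else 0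

/-- **Characterisation of the selected index** (`w ≥ 0`, `0 ≤ u < ∑ w`): `finSelect w u = k` iff
`∑_{i<k} w i ≤ u < ∑_{i≤k} w i`. [folklore] -/
theorem finSelect_eq_iff {w : Fin n → ℝ} (hw : ∀ i, 0 ≤ w i) {u : ℝ} (hu : 0 ≤ u)
    (hex : ∃ k, u < cumSum w k) (k : Fin n) :
    finSelect w u = k ↔ cumSumLT w k ≤ u ∧ u < cumSum w k := by
  rw [finSelect, dif_pos hex, Fin.find_eq_iff]
  constructor
  · rintro ⟨hk, hmin⟩
    refine ⟨?_, hk⟩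
    by_contra hlt
    rw [not_le] at hlt
    obtain ⟨j, hjk, hj⟩ := exists_lt_cumSum_of_lt_cumSumLT hu hlt
    exact hmin j hjk hj
  · rintro ⟨hle, hk⟩
    refine ⟨hk, fun j hjk hj ↦ ?_⟩
    have := cumSum_le_cumSumLT_of_lt hw hjk
    linarith

/-- **The selected index has the prescribed law**: for `w ≥ 0` with `∑ w = 1`, the set of
`u ∈ [0, 1)` selecting `k` is the interval `[∑_{i<k} w i, ∑_{i≤k} w i)`. [folklore] -/
theorem Ico_inter_finSelect_eq {w : Fin n → ℝ} (hw : ∀ i, 0 ≤ w i) (hsum : ∑ i, w i = 1)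
    (k : Fin n) :
    Set.Ico (0 : ℝ) 1 ∩ {u | finSelect w u = k} = Set.Ico (cumSumLT w k) (cumSum w k) := by
  obtain ⟨m, rfl⟩ : ∃ m, n = m + 1 := ⟨n - 1, (Nat.succ_pred_eq_of_pos (NeZero.pos n)).symm⟩
  ext u
  simp only [Set.mem_inter_iff, Set.mem_Ico, Set.mem_setOf_eq]
  constructor
  · rintro ⟨⟨hu0, hu1⟩, hsel⟩
    have hex : ∃ k, u < cumSum w k := ⟨Fin.last m, by rw [cumSum_last, hsum]; exact hu1⟩
    exact (finSelect_eq_iff hw hu0 hex k).1 hsel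
  · rintro ⟨hle, hlt⟩
    have hu0 : 0 ≤ u := (cumSumLT_nonneg hw k).trans hle
    have hu1 : u < 1 := hlt.trans_le (hsum ▸ cumSum_le_sum hw k)
    have hex : ∃ k, u < cumSum w k := ⟨k, hlt⟩
    exact ⟨⟨hu0, hu1⟩, (finSelect_eq_iff hw hu0 hex k).2 ⟨hle, hlt⟩⟩

/-- **The selected index has the prescribed law**: `Leb{u ∈ [0,1) | finSelect w u = k} = w k`
(`w ≥ 0`, `∑ w = 1`). Durrett (2019), proof of Thm. 8.1.1. [folklore] -/
theorem volume_Ico_inter_finSelect {w : Fin n → ℝ} (hw : ∀ i, 0 ≤ w i) (hsum : ∑ i, w i = 1)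
    (k : Fin n) : volume (Set.Ico (0 : ℝ) 1 ∩ {u | finSelect w u = k}) = ENNReal.ofReal (w k) := by
  rw [Ico_inter_finSelect_eq hw hsum k, Real.volume_Ico, cumSum_eq_cumSumLT_add, add_sub_cancel_left]

/-- The fibres of the selection map are finite Boolean combinations of half-lines. [folklore] -/
theorem measurableSet_finSelect_eq (w : Fin n → ℝ) (k : Fin n) :
    MeasurableSet {u | finSelect w u = k} := by
  classical
  have hrepr : {u | finSelect w u = k} =
      ((⋃ j, Set.Iio (cumSum w j)) ∩ (Set.Iio (cumSum w k) ∩ ⋂ j ∈ {j | j < k}, Set.Ici (cumSum w j))) ∪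
        ((⋃ j, Set.Iio (cumSum w j))ᶜ ∩ {_u | (0 : Fin n) = k}) := by
    ext u
    simp only [Set.mem_setOf_eq, Set.mem_union, Set.mem_inter_iff, Set.mem_iUnion, Set.mem_Iio,
      Set.mem_iInter, Set.mem_Ici, Set.mem_compl_iff, not_exists]
    by_cases hex : ∃ j, u < cumSum w j
    · rw [finSelect, dif_pos hex, Fin.find_eq_iff]
      constructor
      · rintro ⟨hk, hmin⟩
        exact Or.inl ⟨hex, hk, fun j hj ↦ not_lt.1 (hmin j hj)⟩
      · rintro (⟨-, hk, hmin⟩ | ⟨hall, -⟩)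
        · exact ⟨hk, fun j hj ↦ not_lt.2 (hmin j hj)⟩
        · obtain ⟨j, hj⟩ := hex; exact absurd hj (hall j)
    · rw [finSelect, dif_neg hex]
      constructor
      · intro h; exact Or.inr ⟨fun j hj ↦ hex ⟨j, hj⟩, h⟩
      · rintro (⟨⟨j, hj⟩, -⟩ | ⟨-, h⟩)
        · exact absurd ⟨j, hj⟩ hex
        · exact h
  rw [hrepr]
  refine MeasurableSet.union ?_ ?_
  · refine (MeasurableSet.iUnion fun j ↦ measurableSet_Iio).inter (measurableSet_Iio.inter ?_)
    exact MeasurableSet.biInter (Set.to_countable _) fun j _ ↦ measurableSet_Ici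
  · exact (MeasurableSet.iUnion fun j ↦ measurableSet_Iio).compl.inter
      (MeasurableSet.const _)

/-- **The selection map is measurable.** [folklore] -/
theorem measurable_finSelect (w : Fin n → ℝ) : Measurable (finSelect w) :=
  measurable_to_countable' fun k ↦ measurableSet_finSelect_eq w k

end FinSelect

/-! ### Weighted selection from a finite set -/

section WSelect

variable {σ : Type*}

/-- **Weighted selection from a finite set** `s` with weights `wt`, driven by `u ∈ [0, 1)`
(through an arbitrary enumeration `s ≃ Fin |s|`; junk `d` if `s = ∅`). Durrett (2019), proof of
Thm. 8.1.1. [folklore] -/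
def wselect (s : Finset σ) (wt : σ → ℝ) (d : σ) (u : ℝ) : σ :=
  if h : s.Nonempty then
    haveI : NeZero s.card := ⟨(Finset.card_pos.2 h).ne'⟩
    ((s.equivFin.symm (finSelect (fun i ↦ wt (s.equivFin.symm i)) u) : s) : σ)
  else d

/-- The selected element belongs to the set (when it is nonempty). [folklore] -/
theorem wselect_mem {s : Finset σ} (hs : s.Nonempty) (wt : σ → ℝ) (d : σ) (u : ℝ) :
    wselect s wt d u ∈ s := by
  rw [wselect, dif_pos hs]
  exact Subtype.coe_prop _

/-- The selection map has finite range. [folklore] -/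
theorem finite_range_wselect (s : Finset σ) (wt : σ → ℝ) (d : σ) :
    (Set.range (wselect s wt d)).Finite := by
  refine (s.finite_toSet.insert d).subset ?_
  rintro _ ⟨u, rfl⟩
  by_cases hs : s.Nonempty
  · exact Set.mem_insert_of_mem _ (wselect_mem hs wt d u)
  · rw [wselect, dif_neg hs]; exact Set.mem_insert _ _

/-- **The selected element has the prescribed law**: for `wt ≥ 0` on `s` with `∑_s wt = 1` and
`x ∈ s`, `Leb{u ∈ [0,1) | wselect = x} = wt x`. Durrett (2019), proof of Thm. 8.1.1. [folklore] -/
theorem volume_Ico_inter_wselect {s : Finset σ} {wt : σ → ℝ} (hw : ∀ x ∈ s, 0 ≤ wt x)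
    (hsum : ∑ x ∈ s, wt x = 1) (d : σ) {x : σ} (hx : x ∈ s) :
    volume (Set.Ico (0 : ℝ) 1 ∩ {u | wselect s wt d u = x}) = ENNReal.ofReal (wt x) := by
  have hs : s.Nonempty := ⟨x, hx⟩
  haveI : NeZero s.card := ⟨(Finset.card_pos.2 hs).ne'⟩
  set e := s.equivFin with he
  set w : Fin s.card → ℝ := fun i ↦ wt (e.symm i) with hwdef
  have hw' : ∀ i, 0 ≤ w i := fun i ↦ hw _ (Subtype.coe_prop _)
  have hsum' : ∑ i, w i = 1 := by
    rw [← hsum, hwdef]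
    rw [← Finset.sum_coe_sort s wt]
    exact e.symm.sum_comp (fun y : s ↦ wt y)
  have hset : {u | wselect s wt d u = x} = {u | finSelect w u = e ⟨x, hx⟩} := by
    ext u
    simp only [Set.mem_setOf_eq]
    rw [wselect, dif_pos hs]
    constructor
    · intro h
      apply e.symm.injective
      rw [Equiv.symm_apply_apply]
      exact Subtype.ext h
    · intro h
      change ((e.symm (finSelect w u) : s) : σ) = x
      rw [h, Equiv.symm_apply_apply]
  rw [hset, volume_Ico_inter_finSelect hw' hsum', hwdef]
  simp only [he, Equiv.symm_apply_apply]

/-- **The selection map is measurable** (whatever the σ-algebra on `σ`: it has finite range and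
measurable fibres). [folklore] -/
theorem measurable_wselect [MeasurableSpace σ] (s : Finset σ) (wt : σ → ℝ) (d : σ) :
    Measurable (wselect s wt d) := by
  by_cases hs : s.Nonempty
  · haveI : NeZero s.card := ⟨(Finset.card_pos.2 hs).ne'⟩
    have : wselect s wt d = (fun k ↦ ((s.equivFin.symm k : s) : σ)) ∘
        finSelect (fun i ↦ wt (s.equivFin.symm i)) := by
      funext u
      rw [wselect, dif_pos hs]
      rfl
    rw [this]
    exact (measurable_of_countable _).comp (measurable_finSelect _)
  · have : wselect s wt d = fun _ ↦ d := by
      funext u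
      rw [wselect, dif_neg hs]
    rw [this]
    exact measurable_const

end WSelect

/-! ### The centred two-point mixture indexed by children -/

section Mixture

variable {Λ : Type*}

/-- The positive part `c⁺ = ∑_{x j > 0} x j p j` of a weighted increment family. Durrett (2019),
proof of Thm. 8.1.1 (`c = ∫_0^∞ v dF(v)`). [folklore] -/
def posMass (C : Finset Λ) (p x : Λ → ℝ) : ℝ := ∑ j ∈ C.filter (fun j ↦ 0 < x j), x j * p j

/-- The negative part `c⁻ = ∑_{x i < 0} (-x i) p i`. Durrett (2019), proof of Thm. 8.1.1
(`c = ∫_{-∞}^0 (-u) dF(u)`). [folklore] -/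
def negMass (C : Finset Λ) (p x : Λ → ℝ) : ℝ := ∑ i ∈ C.filter (fun i ↦ x i < 0), -x i * p i

/-- **Centring identity**: `∑ p x = 0` forces `c⁺ = c⁻`. Durrett (2019), proof of Thm. 8.1.1.
[folklore] -/
theorem posMass_eq_negMass {C : Finset Λ} {p x : Λ → ℝ} (hmean : ∑ k ∈ C, p k * x k = 0) :
    posMass C p x = negMass C p x := by
  have hsplit : ∑ k ∈ C, p k * x k =
      ∑ k ∈ C.filter (fun j ↦ 0 < x j), p k * x k + ∑ k ∈ C.filter (fun j ↦ ¬ 0 < x j), p k * x k :=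
    (sum_filter_add_sum_filter_not C (fun j ↦ 0 < x j) _).symm
  have hneg : ∑ k ∈ C.filter (fun j ↦ ¬ 0 < x j), p k * x k =
      ∑ k ∈ C.filter (fun i ↦ x i < 0), p k * x k := by
    rw [← sum_filter_add_sum_filter_not (C.filter (fun j ↦ ¬ 0 < x j)) (fun i ↦ x i < 0)]
    have h0 : ∑ k ∈ (C.filter (fun j ↦ ¬ 0 < x j)).filter (fun i ↦ ¬ x i < 0), p k * x k = 0 := by
      refine sum_eq_zero fun k hk ↦ ?_
      simp only [mem_filter, not_lt] at hk
      have : x k = 0 := le_antisymm hk.1.2 hk.2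
      rw [this, mul_zero]
    rw [h0, add_zero]
    congr 1
    ext k
    simp only [mem_filter, not_lt, and_assoc]
    constructor
    · rintro ⟨hk, -, h⟩; exact ⟨hk, h⟩
    · rintro ⟨hk, h⟩; exact ⟨hk, h.le, h⟩
  rw [posMass, negMass]
  have : ∑ j ∈ C.filter (fun j ↦ 0 < x j), x j * p j = ∑ k ∈ C.filter (fun j ↦ 0 < x j), p k * x k :=
    sum_congr rfl fun k _ ↦ mul_comm _ _
  rw [this]
  have : ∑ i ∈ C.filter (fun i ↦ x i < 0), -x i * p i = -∑ k ∈ C.filter (fun i ↦ x i < 0), p k * x k := by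
    rw [← sum_neg_distrib]; exact sum_congr rfl fun k _ ↦ by ring
  rw [this]
  linarith [hsplit, hneg, hmean]

/-- `c⁺ ≥ 0` for `p ≥ 0`. [folklore] -/
theorem posMass_nonneg {C : Finset Λ} {p : Λ → ℝ} (x : Λ → ℝ) (hp : ∀ k ∈ C, 0 ≤ p k) :
    0 ≤ posMass C p x :=
  sum_nonneg fun j hj ↦ by
    simp only [mem_filter] at hj
    exact mul_nonneg hj.2.le (hp j hj.1)

variable [DecidableEq Λ]

/-- The **pair weights** of the centred two-point mixture indexed by children: for `x i < 0 < x j`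
the pair `(i, j)` gets `(x j - x i) p i p j / c⁺`; a child with `x i = 0` is the "zero pair"
`(i, i)` with weight `p i`; every other pair gets `0`. Durrett (2019), proof of Thm. 8.1.1,
formula (8.1.1) (`P((U,V) ∈ A) = c⁻¹ ∬_A dF(u) dF(v) (v - u)`, `P{(U,V) = (0,0)} = F({0})`).
[cite: Durrett2019, Thm. 8.1.1] -/
def pairWeight (C : Finset Λ) (p x : Λ → ℝ) (ij : Λ × Λ) : ℝ :=
  if ij.1 ∈ C ∧ ij.2 ∈ C then
    if x ij.1 < 0 ∧ 0 < x ij.2 then (x ij.2 - x ij.1) * p ij.1 * p ij.2 / posMass C p x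
    else if ij.1 = ij.2 ∧ x ij.1 = 0 then p ij.1 else 0
  else 0

/-- The **pair average** of a test function: its mean under the exit distribution of Brownian
motion from `(x i, x j)` started at `0` — `P[exit at x i] = x j/(x j - x i)`,
`P[exit at x j] = -x i/(x j - x i)` (gambler's ruin) — landing on child `i` or `j`; for the
zero pair `(i, i)` it is `φ i`. Durrett (2019), proof of Thm. 8.1.1
(`μ_{u,v}({u}) = v/(v-u)`, `μ_{u,v}({v}) = -u/(v-u)`). [cite: Durrett2019, Thm. 8.1.1] -/
def pairAverage (x : Λ → ℝ) (ij : Λ × Λ) (φ : Λ → ℝ) : ℝ :=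
  if ij.1 = ij.2 then φ ij.1 else (x ij.2 * φ ij.1 - x ij.1 * φ ij.2) / (x ij.2 - x ij.1)

/-- The pair weights vanish off `C × C`. [folklore] -/
theorem pairWeight_eq_zero_of_not_mem {C : Finset Λ} {p x : Λ → ℝ} {ij : Λ × Λ}
    (h : ¬ (ij.1 ∈ C ∧ ij.2 ∈ C)) : pairWeight C p x ij = 0 := by
  rw [pairWeight, if_neg h]

/-- **Support of the pair weights**: a pair of positive weight is either a genuine pair
`x i < 0 < x j` or a zero pair `i = j`, `x i = 0` (of children of `C`). [folklore] -/
theorem pairWeight_ne_zero_imp {C : Finset Λ} {p x : Λ → ℝ} {ij : Λ × Λ}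
    (h : pairWeight C p x ij ≠ 0) :
    (ij.1 ∈ C ∧ ij.2 ∈ C) ∧ ((x ij.1 < 0 ∧ 0 < x ij.2) ∨ (ij.1 = ij.2 ∧ x ij.1 = 0)) := by
  unfold pairWeight at h
  split_ifs at h with h1 h2 h3
  · exact ⟨h1, Or.inl h2⟩
  · exact ⟨h1, Or.inr h3⟩
  · exact absurd rfl h
  · exact absurd rfl h

/-- **The pair weights are nonnegative** (`p ≥ 0` on `C`). [folklore] -/
theorem pairWeight_nonneg {C : Finset Λ} {p : Λ → ℝ} (x : Λ → ℝ) (hp : ∀ k ∈ C, 0 ≤ p k)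
    (ij : Λ × Λ) : 0 ≤ pairWeight C p x ij := by
  unfold pairWeight
  split_ifs with h1 h2 h3
  · exact div_nonneg (mul_nonneg (mul_nonneg (by linarith [h2.1, h2.2]) (hp _ h1.1)) (hp _ h1.2))
      (posMass_nonneg x hp)
  · exact hp _ h1.1
  · exact le_rfl
  · exact le_rfl

/-- The levels of a pair of positive weight lie in `[-L, L]` as soon as all increments do, and
satisfy `x i ≤ 0 ≤ x j`. [folklore] -/
theorem levels_of_pairWeight_ne_zero {C : Finset Λ} {p x : Λ → ℝ} {ij : Λ × Λ}
    (h : pairWeight C p x ij ≠ 0) : x ij.1 ≤ 0 ∧ 0 ≤ x ij.2 := by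
  rcases (pairWeight_ne_zero_imp h).2 with h' | ⟨heq, h0⟩
  · exact ⟨h'.1.le, h'.2.le⟩
  · refine ⟨h0.le, ?_⟩
    rw [← heq, h0]

/-- Row sums of the pair weights: for a child `i` with `x i < 0`,
`∑_j pairWeight (i, j) = p i · (c⁺ - x i π⁺)/c⁺`-type identity in the form
`∑_j pairWeight (i,j) · pairAverage (i,j) φ = (p i / c⁺) ∑_{x j > 0} p j (x j φ i - x i φ j)`.
[folklore] -/
theorem sum_pairWeight_mul_pairAverage_row_neg {C : Finset Λ} {p x : Λ → ℝ} (φ : Λ → ℝ) {i : Λ}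
    (hi : i ∈ C) (hxi : x i < 0) :
    ∑ j ∈ C, pairWeight C p x (i, j) * pairAverage x (i, j) φ =
      p i / posMass C p x * ∑ j ∈ C.filter (fun j ↦ 0 < x j), p j * (x j * φ i - x i * φ j) := by
  rw [mul_sum, ← sum_filter_add_sum_filter_not C (fun j ↦ 0 < x j)]
  have hzero : ∑ j ∈ C.filter (fun j ↦ ¬ 0 < x j), pairWeight C p x (i, j) * pairAverage x (i, j) φ = 0 := by
    refine sum_eq_zero fun j hj ↦ ?_
    simp only [mem_filter] at hj
    have : pairWeight C p x (i, j) = 0 := by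
      unfold pairWeight
      rw [if_pos ⟨hi, hj.1⟩, if_neg (fun h ↦ hj.2 h.2), if_neg (fun h ↦ hxi.ne h.2)]
    rw [this, zero_mul]
  rw [hzero, add_zero]
  refine sum_congr rfl fun j hj ↦ ?_
  simp only [mem_filter] at hj
  have hij : i ≠ j := fun h ↦ by rw [h] at hxi; exact lt_asymm hxi hj.2
  have hden : x j - x i ≠ 0 := by linarith [hj.2]
  unfold pairWeight pairAverage
  rw [if_pos ⟨hi, hj.1⟩, if_pos ⟨hxi, hj.2⟩, if_neg hij]
  field_simp

/-- Row sums for a zero child: `∑_j pairWeight (i,j) · pairAverage (i,j) φ = p i φ i`.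
[folklore] -/
theorem sum_pairWeight_mul_pairAverage_row_zero {C : Finset Λ} {p x : Λ → ℝ} (φ : Λ → ℝ)
    {i : Λ} (hi : i ∈ C) (hxi : x i = 0) :
    ∑ j ∈ C, pairWeight C p x (i, j) * pairAverage x (i, j) φ = p i * φ i := by
  rw [← Finset.sum_erase_add _ _ hi]
  have hzero : ∑ j ∈ C.erase i, pairWeight C p x (i, j) * pairAverage x (i, j) φ = 0 := by
    refine sum_eq_zero fun j hj ↦ ?_
    have hji : i ≠ j := (Finset.ne_of_mem_erase hj).symm
    have : pairWeight C p x (i, j) = 0 := by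
      unfold pairWeight
      rw [if_pos ⟨hi, Finset.mem_of_mem_erase hj⟩, if_neg (fun h ↦ by rw [hxi] at h; exact lt_irrefl _ h.1),
        if_neg (fun h ↦ hji h.1)]
    rw [this, zero_mul]
  rw [hzero, zero_add]
  unfold pairWeight pairAverage
  rw [if_pos ⟨hi, hi⟩, if_neg (fun h ↦ by rw [hxi] at h; exact lt_irrefl _ h.1), if_pos ⟨rfl, hxi⟩,
    if_pos rfl]

/-- Row sums for a positive child vanish: no pair starts at `i` with `x i > 0`. [folklore] -/
theorem sum_pairWeight_mul_pairAverage_row_pos {C : Finset Λ} {p x : Λ → ℝ} (φ : Λ → ℝ)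
    {i : Λ} (hxi : 0 < x i) :
    ∑ j ∈ C, pairWeight C p x (i, j) * pairAverage x (i, j) φ = 0 := by
  refine sum_eq_zero fun j _ ↦ ?_
  have : pairWeight C p x (i, j) = 0 := by
    unfold pairWeight
    split_ifs with h1 h2 h3
    · exact absurd h2.1 (not_lt.2 hxi.le)
    · exact absurd h3.2 hxi.ne'
    · rfl
    · rfl
  rw [this, zero_mul]

omit [DecidableEq Λ] in
/-- If `c⁺ = 0` then `p` vanishes on the children with `x > 0` (all terms of `c⁺` are `≥ 0`).
[folklore] -/
theorem p_eq_zero_of_posMass_eq_zero {C : Finset Λ} {p x : Λ → ℝ} (hp : ∀ k ∈ C, 0 ≤ p k)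
    (h0 : posMass C p x = 0) {j : Λ} (hj : j ∈ C) (hxj : 0 < x j) : p j = 0 := by
  have hterms : ∀ k ∈ C.filter (fun j ↦ 0 < x j), 0 ≤ x k * p k := fun k hk ↦ by
    simp only [mem_filter] at hk; exact mul_nonneg hk.2.le (hp k hk.1)
  have := (sum_eq_zero_iff_of_nonneg hterms).1 h0 j (by simp [hj, hxj])
  rcases mul_eq_zero.1 this with h | h
  · exact absurd h hxj.ne'
  · exact h

omit [DecidableEq Λ] in
/-- If `c⁻ = 0` then `p` vanishes on the children with `x < 0`. [folklore] -/
theorem p_eq_zero_of_negMass_eq_zero {C : Finset Λ} {p x : Λ → ℝ} (hp : ∀ k ∈ C, 0 ≤ p k)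
    (h0 : negMass C p x = 0) {i : Λ} (hi : i ∈ C) (hxi : x i < 0) : p i = 0 := by
  have hterms : ∀ k ∈ C.filter (fun i ↦ x i < 0), 0 ≤ -x k * p k := fun k hk ↦ by
    simp only [mem_filter] at hk; exact mul_nonneg (by linarith [hk.2]) (hp k hk.1)
  have := (sum_eq_zero_iff_of_nonneg hterms).1 h0 i (by simp [hi, hxi])
  rcases mul_eq_zero.1 this with h | h
  · exact absurd h (by linarith)
  · exact h

/-- **The mixture identity** (Durrett (2019), proof of Thm. 8.1.1:
"`∫ φ(x) dF(x) = E(∫ φ(x) μ_{U,V}(dx))`", finitely supported and indexed by children): for `p ≥ 0`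
on `C` with `∑_C p = 1` and `∑_C p x = 0`, and every test function `φ`,
`∑_{(i,j) ∈ C × C} pairWeight (i,j) · pairAverage x (i,j) φ = ∑_{k ∈ C} p k φ k`.
With `φ ≡ 1` the pair weights sum to `1`; with `φ = 𝟙_{k}` the child `k` is produced with
probability `p k`. [cite: Durrett2019, Thm. 8.1.1] -/
theorem sum_pairWeight_mul_pairAverage {C : Finset Λ} {p x : Λ → ℝ} (hp : ∀ k ∈ C, 0 ≤ p k)
    (hmean : ∑ k ∈ C, p k * x k = 0) (φ : Λ → ℝ) :
    ∑ ij ∈ C ×ˢ C, pairWeight C p x ij * pairAverage x ij φ = ∑ k ∈ C, p k * φ k := by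
  rw [sum_product]
  -- the rows according to the sign of `x i`
  have hrow : ∀ i ∈ C, ∑ j ∈ C, pairWeight C p x (i, j) * pairAverage x (i, j) φ =
      (if x i < 0 then p i / posMass C p x *
          ∑ j ∈ C.filter (fun j ↦ 0 < x j), p j * (x j * φ i - x i * φ j) else 0) +
        (if x i = 0 then p i * φ i else 0) := by
    intro i hi
    rcases lt_trichotomy (x i) 0 with hlt | heq | hgt
    · rw [if_pos hlt, if_neg hlt.ne, add_zero, sum_pairWeight_mul_pairAverage_row_neg φ hi hlt]
    · rw [if_neg (by rw [heq]; exact lt_irrefl 0), if_pos heq, zero_add,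
        sum_pairWeight_mul_pairAverage_row_zero φ hi heq]
    · rw [if_neg (not_lt.2 hgt.le), if_neg hgt.ne', add_zero,
        sum_pairWeight_mul_pairAverage_row_pos φ hgt]
  rw [sum_congr rfl hrow, sum_add_distrib, ← sum_filter, ← sum_filter]
  -- the three parts of `∑_C p φ`
  have hZP : ∑ k ∈ C.filter (fun i ↦ ¬ x i < 0), p k * φ k =
      ∑ k ∈ C.filter (fun i ↦ x i = 0), p k * φ k + ∑ k ∈ C.filter (fun j ↦ 0 < x j), p k * φ k := by
    rw [add_comm, ← sum_filter_add_sum_filter_not (C.filter fun i ↦ ¬ x i < 0) (fun i ↦ 0 < x i)]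
    congr 1
    · congr 1; ext k; simp only [mem_filter, not_lt, and_assoc]
      exact ⟨fun ⟨hk, _, h⟩ ↦ ⟨hk, h⟩, fun ⟨hk, h⟩ ↦ ⟨hk, h.le, h⟩⟩
    · congr 1; ext k; simp only [mem_filter, not_lt, and_assoc]
      exact ⟨fun ⟨hk, h1, h2⟩ ↦ ⟨hk, le_antisymm h2 h1⟩, fun ⟨hk, h⟩ ↦ ⟨hk, h.ge, h.le⟩⟩
  have htarget : ∑ k ∈ C, p k * φ k = ∑ k ∈ C.filter (fun i ↦ x i < 0), p k * φ k +
      ∑ k ∈ C.filter (fun i ↦ x i = 0), p k * φ k + ∑ k ∈ C.filter (fun j ↦ 0 < x j), p k * φ k := by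
    rw [← sum_filter_add_sum_filter_not C (fun i ↦ x i < 0), hZP, add_assoc]
  rw [htarget]
  have hc := posMass_eq_negMass hmean
  -- it remains to identify the negative rows with `∑_N p φ + ∑_P p φ`
  suffices hkey : ∑ i ∈ C.filter (fun i ↦ x i < 0), p i / posMass C p x *
      ∑ j ∈ C.filter (fun j ↦ 0 < x j), p j * (x j * φ i - x i * φ j) =
      ∑ k ∈ C.filter (fun i ↦ x i < 0), p k * φ k + ∑ k ∈ C.filter (fun j ↦ 0 < x j), p k * φ k by
    rw [hkey]; ring
  by_cases h0 : posMass C p x = 0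
  · -- degenerate case: `p` vanishes on the negative and on the positive children
    have hPz : ∀ j ∈ C.filter (fun j ↦ 0 < x j), p j = 0 := fun j hj ↦ by
      simp only [mem_filter] at hj; exact p_eq_zero_of_posMass_eq_zero hp h0 hj.1 hj.2
    have hNz : ∀ i ∈ C.filter (fun i ↦ x i < 0), p i = 0 := fun i hi ↦ by
      simp only [mem_filter] at hi
      exact p_eq_zero_of_negMass_eq_zero hp (hc ▸ h0) hi.1 hi.2
    rw [sum_eq_zero fun i hi ↦ by rw [hNz i hi, zero_div, zero_mul],
      sum_eq_zero fun i hi ↦ by rw [hNz i hi, zero_mul],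
      sum_eq_zero fun j hj ↦ by rw [hPz j hj, zero_mul], add_zero]
  · -- generic case: `c⁺ = c⁻ ≠ 0`
    have hexp : ∀ i ∈ C.filter (fun i ↦ x i < 0), p i / posMass C p x *
        ∑ j ∈ C.filter (fun j ↦ 0 < x j), p j * (x j * φ i - x i * φ j) =
        (p i * φ i * posMass C p x +
          (-x i * p i) * ∑ j ∈ C.filter (fun j ↦ 0 < x j), p j * φ j) / posMass C p x := by
      intro i _
      have hsum : ∑ j ∈ C.filter (fun j ↦ 0 < x j), p j * (x j * φ i - x i * φ j) =
          φ i * posMass C p x - x i * ∑ j ∈ C.filter (fun j ↦ 0 < x j), p j * φ j := by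
        rw [posMass, mul_sum, mul_sum, ← sum_sub_distrib]
        exact sum_congr rfl fun j _ ↦ by ring
      rw [hsum]
      field_simp
      ring
    rw [sum_congr rfl hexp, ← sum_div, sum_add_distrib, ← sum_mul, ← sum_mul]
    have hneg : ∑ i ∈ C.filter (fun i ↦ x i < 0), -x i * p i = posMass C p x := by
      rw [hc, negMass]
    rw [hneg]
    field_simp

/-- **The pair weights sum to one** (`φ ≡ 1` in the mixture identity). Durrett (2019), proof of
Thm. 8.1.1 ("Letting `φ ≡ 1` … shows that the measure defined in (8.1.1) has total mass 1").
[cite: Durrett2019, Thm. 8.1.1] -/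
theorem sum_pairWeight_eq_one {C : Finset Λ} {p x : Λ → ℝ} (hp : ∀ k ∈ C, 0 ≤ p k)
    (hsum : ∑ k ∈ C, p k = 1) (hmean : ∑ k ∈ C, p k * x k = 0) :
    ∑ ij ∈ C ×ˢ C, pairWeight C p x ij = 1 := by
  have h := sum_pairWeight_mul_pairAverage hp hmean (fun _ ↦ 1)
  have h1 : ∀ ij ∈ C ×ˢ C, pairWeight C p x ij * pairAverage x ij (fun _ ↦ 1) = pairWeight C p x ij := by
    intro ij _
    by_cases hw : pairWeight C p x ij = 0
    · rw [hw, zero_mul]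
    · have hsupp := pairWeight_ne_zero_imp hw
      unfold pairAverage
      split_ifs with heq
      · rw [mul_one]
      · rcases hsupp.2 with h' | h'
        · have : x ij.2 - x ij.1 ≠ 0 := by linarith [h'.1, h'.2]
          field_simp
        · exact absurd h'.1 heq
  rw [sum_congr rfl h1] at h
  rw [h]
  simpa using hsum

/-- **Each child is produced with its probability** (`φ = 𝟙_{k}` in the mixture identity):
`∑_{(i,j)} pairWeight (i,j) · pairAverage x (i,j) 𝟙_{k} = p k` for `k ∈ C`. Durrett (2019),
proof of Thm. 8.1.1 (`B(T_{U,V}) =_d X`). [cite: Durrett2019, Thm. 8.1.1] -/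
theorem sum_pairWeight_mul_pairAverage_indicator {C : Finset Λ} {p x : Λ → ℝ}
    (hp : ∀ k ∈ C, 0 ≤ p k) (hmean : ∑ k ∈ C, p k * x k = 0) {k : Λ} (hk : k ∈ C) :
    ∑ ij ∈ C ×ˢ C, pairWeight C p x ij * pairAverage x ij (fun l ↦ if l = k then 1 else 0) = p k := by
  rw [sum_pairWeight_mul_pairAverage hp hmean]
  simp [Finset.sum_ite_eq', hk]

end Mixture

end Literature.Probability.RandomPlanarGeometry.SkorokhodEmbedding
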